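import Mathlib
import Summits.Ventures.PercRepro2.HCov
import Summits.Ventures.PercRepro2.RECMReduction
import Summits.Ventures.PercRepro2.RECMReductionC
import Summits.Ventures.PercRepro2.A3Reduction
import Summits.Ventures.PercRepro2.CCWReduction
import Summits.Ventures.PercRepro2.CCWReduced
import Summits.Ventures.PercRepro2.CCWTyped
import Summits.Ventures.PercRepro2.CCWReducedTyped
import Summits.Ventures.PercRepro2.HubModel
import Summits.Ventures.PercRepro2.HubGc
import Summits.Ventures.PercRepro2.HubTheorem
import Summits.Ventures.PercRepro2.HubTypedTheorem
import Summits.Ventures.PercRepro2.HubModel3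
import Summits.Ventures.PercRepro2.HubGc3
import Summits.Ventures.PercRepro2.HubTheorem3

/-!
# The hub classes R and R₃ discharged in the reductions (blind cell PercRepro2, typer-1 g52)

The reductions of (HCOV) to a root-edge or `a₃`-edge hypothesis — `RECM.HCov_all_of_RECM_all`,
`HCov_all_of_cRECM_all`, `HCov_all_of_cCW_all`, `HCov_all_of_cCWRedS_all`, `HCov_all_of_cCWTyped_all`,
`HCov_all_of_cCWRedSTyped_all`, `A3RECM.HCov_all_of_A3RECM_all` — carry the hub theorems as
HYPOTHESES: `RECM.HCovR_all` ((HCOV) on class R: every root edge joins two marks), `RECM.TypedBasesR_all`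
(row 2′TRI on class R) and `A3RECM.HCovR3_all` ((HCOV) on class R₃: every edge at `a₃` joins two
marks). The hub theorems themselves are in the tree in the `Hub.Mark` vocabulary:
`Hub.HCov_of_classR`, `Hub.TypedBases_of_classR` (typer-1), `Hub3.HCov_of_classR3`.

This file translates the vocabularies (`classR_of_rootsToMarks`, `classR3_of_a3ToMarks`,
`markOf_injective` / `markOf3_injective` for five distinct marks), DISCHARGES the three hypotheses
(**`HCovR_all_holds`**, **`TypedBasesR_all_holds`**, **`HCovR3_all_holds`**) and restates the
reductions without them: e.g. **`HCov_all_of_RECM_all'`** — row (RECM-UY) ALONE implies the crux —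
and **`HCov_all_of_A3RECM_all'`**.
-/

namespace Summit.Ventures.PercRepro2

open CovForm RECM Hub

namespace HubAll

/-! ## The marking of five distinct marks is injective -/

section Marks

variable {V : Type*}

/-- `Hub.markOf` is injective for five distinct marks. -/
lemma markOf_injective {o a₁ a₂ a₃ b : V} (h12 : a₁ ≠ a₂) (h13 : a₁ ≠ a₃) (h23 : a₂ ≠ a₃)
    (ho1 : o ≠ a₁) (ho2 : o ≠ a₂) (ho3 : o ≠ a₃) (hob : o ≠ b) (hb1 : b ≠ a₁) (hb2 : b ≠ a₂)
    (hb3 : b ≠ a₃) : Function.Injective (markOf o a₁ a₂ a₃ b) := by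
  intro m m' h
  cases m <;> cases m' <;> simp_all [markOf]

/-- `Hub3.markOf3` is injective for five distinct marks. -/
lemma markOf3_injective {o a₁ a₂ a₃ b : V} (h12 : a₁ ≠ a₂) (h13 : a₁ ≠ a₃) (h23 : a₂ ≠ a₃)
    (ho1 : o ≠ a₁) (ho2 : o ≠ a₂) (ho3 : o ≠ a₃) (hob : o ≠ b) (hb1 : b ≠ a₁) (hb2 : b ≠ a₂)
    (hb3 : b ≠ a₃) : Function.Injective (Hub3.markOf3 o a₁ a₂ a₃ b) := by
  intro m m' h
  cases m <;> cases m' <;> simp_all [Hub3.markOf3]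

/-- Every mark is the image of some `Mark` under `markOf`. -/
lemma exists_markOf {o a₁ a₂ a₃ b z : V} (hz : z = o ∨ z = a₁ ∨ z = a₂ ∨ z = a₃ ∨ z = b) :
    ∃ m, markOf o a₁ a₂ a₃ b m = z := by
  rcases hz with rfl | rfl | rfl | rfl | rfl
  exacts [⟨.o, rfl⟩, ⟨.a₁, rfl⟩, ⟨.a₂, rfl⟩, ⟨.a₃, rfl⟩, ⟨.b, rfl⟩]

/-- Every mark is the image of some `Mark` under `markOf3`. -/
lemma exists_markOf3 {o a₁ a₂ a₃ b z : V} (hz : z = o ∨ z = a₁ ∨ z = a₂ ∨ z = a₃ ∨ z = b) :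
    ∃ m, Hub3.markOf3 o a₁ a₂ a₃ b m = z := by
  rcases hz with rfl | rfl | rfl | rfl | rfl
  exacts [⟨.o, rfl⟩, ⟨.a₁, rfl⟩, ⟨.a₂, rfl⟩, ⟨.a₃, rfl⟩, ⟨.b, rfl⟩]

end Marks

/-! ## The class vocabularies -/

section Classes

variable {V : Type*} {E : Type*}

/-- `RECM.RootsToMarks` (every edge at a root ends in a mark) is `Hub.ClassR` for the marking
`markOf`. -/
lemma classR_of_rootsToMarks {ends : E → Sym2 V} {o a₁ a₂ a₃ b : V}
    (hR : RootsToMarks ends o a₁ a₂ a₃ b) : ClassR ends (markOf o a₁ a₂ a₃ b) := by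
  intro e he
  obtain ⟨x, hx, y, hxy⟩ := mem_touches.1 he
  simp only [Set.mem_insert_iff, Set.mem_singleton_iff] at hx
  have hroot : a₁ ∈ ends e ∨ a₂ ∈ ends e := by
    rcases hx with rfl | rfl
    · exact Or.inl (by rw [hxy]; exact Sym2.mem_mk_left _ _)
    · exact Or.inr (by rw [hxy]; exact Sym2.mem_mk_left _ _)
  have hall := hR e hroot
  obtain ⟨m, hm⟩ := exists_markOf (hall x (by rw [hxy]; exact Sym2.mem_mk_left x y))
  obtain ⟨m', hm'⟩ := exists_markOf (hall y (by rw [hxy]; exact Sym2.mem_mk_right x y))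
  exact ⟨m, m', by rw [hxy, hm, hm']⟩

/-- `A3RECM.A3ToMarks` (every edge at `a₃` ends in a mark) is `Hub3.ClassR3` for the marking
`markOf3`. -/
lemma classR3_of_a3ToMarks {ends : E → Sym2 V} {o a₁ a₂ a₃ b : V}
    (hR : A3RECM.A3ToMarks ends o a₁ a₂ a₃ b) : Hub3.ClassR3 ends (Hub3.markOf3 o a₁ a₂ a₃ b) := by
  intro e he
  obtain ⟨x, hx, y, hxy⟩ := mem_touches.1 he
  simp only [Set.mem_singleton_iff] at hx
  subst hx
  have hall := hR e (by rw [hxy]; exact Sym2.mem_mk_left _ _)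
  obtain ⟨m, hm⟩ := exists_markOf3 (hall _ (by rw [hxy]; exact Sym2.mem_mk_left _ y))
  obtain ⟨m', hm'⟩ := exists_markOf3 (hall y (by rw [hxy]; exact Sym2.mem_mk_right _ y))
  exact ⟨m, m', by rw [hxy, hm, hm']⟩

end Classes

/-! ## The hub hypotheses discharged -/

section Discharge

variable {R : Type*} [Field R] [LinearOrder R] [IsStrictOrderedRing R]

/-- **(HCOV) on class R holds** (`Hub.HCov_of_classR` in the vocabulary of `RECM.HCovR_all`). -/
theorem HCovR_all_holds : HCovR_all R := by
  intro V E _ _ _ _ ends p hp o a₁ a₂ a₃ b h12 h13 h23 ho1 ho2 ho3 hob hb1 hb2 hb3 hR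
  exact Hub.HCov_of_classR p hp ends o a₁ a₂ a₃ b
    (markOf_injective h12 h13 h23 ho1 ho2 ho3 hob hb1 hb2 hb3) (classR_of_rootsToMarks hR)

/-- **Row 2′TRI on class R holds** (`Hub.TypedBases_of_classR` in the vocabulary of
`RECM.TypedBasesR_all`). -/
theorem TypedBasesR_all_holds : TypedBasesR_all R := by
  intro V E _ _ _ _ ends o a₁ a₂ a₃ b h12 h13 h23 ho1 ho2 ho3 hob hb1 hb2 hb3 hR
  exact Hub.TypedBases_of_classR ends o a₁ a₂ a₃ b
    (markOf_injective h12 h13 h23 ho1 ho2 ho3 hob hb1 hb2 hb3) (classR_of_rootsToMarks hR)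

/-- **(HCOV) on class R₃ holds** (`Hub3.HCov_of_classR3` in the vocabulary of
`A3RECM.HCovR3_all`). -/
theorem HCovR3_all_holds : A3RECM.HCovR3_all R := by
  intro V E _ _ _ _ ends p hp o a₁ a₂ a₃ b h12 h13 h23 ho1 ho2 ho3 hob hb1 hb2 hb3 hR
  exact Hub3.HCov_of_classR3 p hp ends o a₁ a₂ a₃ b
    (markOf3_injective h12 h13 h23 ho1 ho2 ho3 hob hb1 hb2 hb3) (classR3_of_a3ToMarks hR)

end Discharge

/-! ## The reductions without the hub hypotheses -/

section Unconditional

variable {R : Type*} [Field R] [LinearOrder R] [IsStrictOrderedRing R]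

/-- **Row (RECM-UY) alone implies the crux**: `RECM_all → HCov_all`. -/
theorem HCov_all_of_RECM_all' (hR : RECM_all R) : HCov_all R :=
  HCov_all_of_RECM_all hR HCovR_all_holds

/-- `0 ≤ c → cRECM_all c → HCov_all`. -/
theorem HCov_all_of_cRECM_all' {c : R} (hc : 0 ≤ c) (hR : cRECM_all R c) : HCov_all R :=
  HCov_all_of_cRECM_all hc hR HCovR_all_holds

/-- `(∃ c > 0, cRECM_all c) → HCov_all`. -/
theorem HCov_all_of_exists_cRECM' (hR : ∃ c : R, 0 < c ∧ cRECM_all R c) : HCov_all R :=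
  HCov_all_of_exists_cRECM hR HCovR_all_holds

/-- `0 ≤ c → cCW_all c → HCov_all`. -/
theorem HCov_all_of_cCW_all' {c : R} (hc : 0 ≤ c) (hCW : cCW_all R c) : HCov_all R :=
  HCov_all_of_cCW_all hc hCW HCovR_all_holds

/-- `0 ≤ c → cCWRedS_all c → HCov_all` (the reduced class of simple graphs). -/
theorem HCov_all_of_cCWRedS_all' {c : R} (hc : 0 ≤ c) (hCW : cCWRedS_all R c) : HCov_all R :=
  HCov_all_of_cCWRedS_all hc hCW HCovR_all_holds

/-- `0 ≤ c → cCWRed_all c → HCov_all`. -/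
theorem HCov_all_of_cCWRed_all' {c : R} (hc : 0 ≤ c) (hCW : cCWRed_all R c) : HCov_all R :=
  HCov_all_of_cCWRed_all hc hCW HCovR_all_holds

/-- `0 ≤ c → cCWTyped_all c → HCov_all` (the typed bridge). -/
theorem HCov_all_of_cCWTyped_all' {c : R} (hc : 0 ≤ c) (hT : cCWTyped_all R c) : HCov_all R :=
  HCov_all_of_cCWTyped_all hc hT HCovR_all_holds

/-- `0 ≤ c → cCWRedSTyped_all c → HCov_all` (the typed bridge on the reduced class). -/
theorem HCov_all_of_cCWRedSTyped_all' {c : R} (hc : 0 ≤ c) (hT : cCWRedSTyped_all R c) :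
    HCov_all R :=
  HCov_all_of_cCWRedSTyped_all hc hT HCovR_all_holds

/-- **The `a₃`-edge reduction alone implies the crux**: `A3RECM_all → HCov_all`. -/
theorem HCov_all_of_A3RECM_all' (hR : A3RECM.A3RECM_all R) : HCov_all R :=
  A3RECM.HCov_all_of_A3RECM_all hR HCovR3_all_holds

end Unconditional

end HubAll

end Summit.Ventures.PercRepro2
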